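import Summits.QuantumFields.YangMills.Theorems.BalabanUVNodesN15KingModelFullPropagatorGradProfile
import Summits.QuantumFields.YangMills.Theorems.BalabanUVNodesN15KingModelFullPropagatorProfileDecay

/-!
# BalabanUVNodes ∕ N15 — THE KING-MODEL RUNG, CURVED EDITION (PART R-e): THE GRADIENT TWINS OF PART R-d — gradient profile × block decay,
# `|∂^η_μG^η_K(x, y)| ≤ C·(L^K∕r)^{d}·e^{−δ|B(x) − B(y)|}` for all `x ≠ y`, and part O-a′'s off-diagonal gradient decay with its threshold
# `D₀` REPLACED BY `2`
# (Track A, DAG node N15 = NE2; FAN-OUT v1.1 §N15 s3 «KING-MODEL RUNG … + the one-line statement of what the curved case adds»)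

HONEST FRAMING.  Count-neutral kernel bookkeeping (cell `pub-ymgap`, seat `pub-ymgap-dag-n15-e` g8; `--supports stmt-QuantumFields-20296
--as helper` = K3⁵ `SpineGivenEndpointR13SepCoP`, WORDS-141).  TEMPLATE LITERATURE, `A = 0`: C. King's scalar U(1)-Higgs MODEL on finite tori ([King1986]
§2.2 p. 653 (2.13)–(2.17), p. 654 (2.20), Theorem 3.3 pp. 655–656 ((3.7) p. 656, derivative clause), Prop. 3.7 (3.63) p. 663 gradient clause
«`|∂^η_μG^η_{(j)}(x, y)| ≤ C(L^jη)^{1−d}exp[−δ₀(L^jη)^{−1}|x − y|]`»), NOT Bałaban's covariant objects; the statements below are (2.17)-SUMMED SHAPES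
for King's (2.13) at `A = 0`, NOT printed propositions; NE2⁺ is NOT PRINTED and not proved here; NOT a node discharge; nothing continuum ∕ ℝ⁴ ∕ OS ∕
mass-gap ∕ Clay.  0 `sorry`, 0 `def`, standard axioms.

THE POINT.  Part R-d multiplied the KERNEL's level profile by the unit-block decay and replaced part O-a's threshold `D₀` by `2`; THIS FILE does the
same for the GRADIENT `∂^η_μG^η_K(x, y) = L^K[G(x + e_μ, y) − G(x, y)]` (part R-c's profile, part O-a′'s decay):
* §1 ★ **`fullPropD_profile_decay_unif`** — all pairs: `|∂^η_μG^η_K(x, y)| ≤ C·(Σ_{i<K}(ΛL)^i e^{−δrL^i∕N})·e^{−δ|B(x)−B(y)|_M}` (part R-d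
  `levelSum_decay_split` works for any per-level factor);
* §2 ★★ **`fullPropD_powerLaw_decay_unif`** (`d ≥ 1`, `x ≠ y`): `≤ C·((L^K)∕r)^{d}·e^{−δ|B(x)−B(y)|_M}` — the printed SHAPE «`C|x − y|^{1−d}e^{−δ|x−y|}`»
  of Theorem 3.3 ∕ [Ba 4] (derivative clause) for the FULL propagator; `fullPropD_diag_decay_le_unif` (all pairs `≤ C·(L^K)^{d}·e^{−δ|B(x)−B(y)|}`);
* §3 ★ **`fullPropD_decay_two_blocks_unif`** (`d ≥ 1`): part O-a′'s `fullPropD_decay_unif` with its threshold `D₀` REPLACED BY `2`.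
WHAT THE CURVED CASE ADDS (one line): the same for `∇_UG_k(U)` uniformly over `Reg335`.
HONEST SCOPE.  (i) `A = 0`, periodic b.c., odd `L ≥ 3`, `0 < m² ≤ m₀²`, cubes `2L^e`; (ii) lattice units of level `K`; (iii) `K ≥ 1`, `d ≥ 1` for §2–§3;
(iv) the decay rate is half of part R-c's; (v) not Bałaban's `∇G_k(U)`; not a discharge.
Locators: [King1986] C. King, CMP **102** (1986) 649–677: (2.13)–(2.17) p. 653, (2.20) p. 654, Theorem 3.3 p. 655, (3.7) p. 656, Prop. 3.7 (3.63)
p. 663; [Ba 4] = [Balaban1983RegularityDecay] Theorem (1.10) p. 573 (clause 2).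
-/

noncomputable section

namespace Summit.QuantumFields.YangMills.BalabanUVNodes.N15KingModelRung.Curved

open Real Finset Matrix
open Literature.MathematicalPhysics.QuantumFieldTheory.Balaban1983to89.B5Prop11Plancherel (Tor fine unitVec)
open Literature.MathematicalPhysics.QuantumFieldTheory.King1986 (aK aK_pos)
open Literature.MathematicalPhysics.QuantumFieldTheory.King1986.Torus (constrainedProp blockOf tdistT tdistT_nonneg)

variable {d : ℕ} (L : ℕ) [NeZero L]

/-! ## §1 The gradient profile with the block decay, all pairs -/

/-- **THE GRADIENT PROFILE WITH THE UNIT-SCALE DECAY, ALL PAIRS**: for odd `L ≥ 3`, `a > 0`, `m₀² ≥ 0` there are `C, δ > 0` such that for EVERY `K ≥ 1`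
(any spelling `N = L^K`), cube `M_μ = 2L^e`, mass `0 < m² ≤ m₀²` and ALL fine `x, y` (fine distance `r`, unit blocks `B(x), B(y)`):
`|∂^η_μG^η_K(x, y)| ≤ C·(Σ_{i<K} (ΛL)^i·exp(−δ·r·L^i∕L^K))·exp(−δ·|B(x) − B(y)|_M)` — part R-c's level profile TIMES part O-a′'s block decay, with no
threshold (part R-c `fullPropD_profile_unif` + part R-d `levelSum_decay_split` + part O-a `mul_tdistT_blockOf_le`).
[cite: King1986, (2.13)–(2.17) p.653, (2.20) p.654, Theorem 3.3 p.655, (3.7) p.656, Prop. 3.7 (3.63) p.663; Balaban1983RegularityDecay, Theorem (1.10) p.573] -/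
theorem fullPropD_profile_decay_unif (hLodd : Odd L) (hL : 2 ≤ L) {a : ℝ} (ha : 0 < a) {m0sq : ℝ} (hm0 : 0 ≤ m0sq) :
    ∃ C δ : ℝ, 0 < C ∧ 0 < δ ∧ ∀ (K : ℕ), 1 ≤ K → ∀ (N : ℕ) [NeZero N], N = L ^ K →
      ∀ (e : ℕ) (M : Fin (d + 1) → ℕ) [∀ μ, NeZero (M μ)], (∀ μ, M μ = 2 * L ^ e) →
      ∀ (msq : ℝ), 0 < msq → msq ≤ m0sq → ∀ (μ : Fin (d + 1)) (x y : Tor (fine N M)),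
        |(N : ℝ) * (constrainedProp N M (aK a L K) (((N : ℕ) : ℝ) ^ 2) msq (x + unitVec (fine N M) μ) y
            - constrainedProp N M (aK a L K) (((N : ℕ) : ℝ) ^ 2) msq x y)|
          ≤ C * (∑ i ∈ Finset.range K, ((L : ℝ) ^ (d + 1) / (L : ℝ) ^ 2 * L) ^ i
              * Real.exp (-(δ * (tdistT (fine N M) x y * (L : ℝ) ^ i / (N : ℝ)))))
            * Real.exp (-(δ * tdistT M (blockOf N M x) (blockOf N M y))) := by
  have hLr : (1 : ℝ) ≤ L := by exact_mod_cast (show 1 ≤ L by omega)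
  obtain ⟨C₀, δ₀, hC₀, hδ₀, H⟩ := fullPropD_profile_unif (d := d) L hLodd hL ha hm0
  refine ⟨C₀ * Real.exp (δ₀ / 2), δ₀ / 2, by positivity, by positivity, ?_⟩
  intro K hK N _ hN e M _ hM msq hmsq hcap μ x y
  have h := H K hK N hN e M hM msq hmsq hcap μ x y
  set Λ : ℝ := (L : ℝ) ^ (d + 1) / (L : ℝ) ^ 2 * L with hΛdef
  have hΛ : 0 ≤ Λ := by positivity
  set r : ℝ := tdistT (fine N M) x y with hrdef
  set D : ℝ := tdistT M (blockOf N M x) (blockOf N M y) with hDdef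
  have hN1 : (1 : ℝ) ≤ (N : ℝ) := by
    rw [hN]
    exact_mod_cast Nat.one_le_pow K L (by omega)
  have hD : (N : ℝ) * D ≤ r + ((N : ℝ) - 1) := mul_tdistT_blockOf_le N M x y
  have hsplit := levelSum_decay_split (K := K) hΛ hLr hδ₀.le (tdistT_nonneg _ x y) hN1 hD
  have hS0 : 0 ≤ ∑ i ∈ Finset.range K, Λ ^ i * Real.exp (-(δ₀ / 2 * (r * (L : ℝ) ^ i / (N : ℝ)))) :=
    Finset.sum_nonneg fun i _ => by positivity
  calc |(N : ℝ) * (constrainedProp N M (aK a L K) (((N : ℕ) : ℝ) ^ 2) msq (x + unitVec (fine N M) μ) y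
            - constrainedProp N M (aK a L K) (((N : ℕ) : ℝ) ^ 2) msq x y)|
      ≤ C₀ * ∑ i ∈ Finset.range K, Λ ^ i * Real.exp (-(δ₀ * (r * (L : ℝ) ^ i / (N : ℝ)))) := h
    _ ≤ C₀ * (Real.exp (δ₀ / 2) * Real.exp (-(δ₀ / 2 * D))
          * ∑ i ∈ Finset.range K, Λ ^ i * Real.exp (-(δ₀ / 2 * (r * (L : ℝ) ^ i / (N : ℝ))))) :=
        mul_le_mul_of_nonneg_left hsplit hC₀.le
    _ = C₀ * Real.exp (δ₀ / 2) * (∑ i ∈ Finset.range K, Λ ^ i * Real.exp (-(δ₀ / 2 * (r * (L : ℝ) ^ i / (N : ℝ)))))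
          * Real.exp (-(δ₀ / 2 * D)) := by ring

/-! ## §2 Gradient power law × block decay (`d ≥ 1`) -/

/-- **THE PRINTED SHAPE «`C|x − y|^{1−d}e^{−δ|x−y|}`» FOR THE GRADIENT OF THE FULL `A = 0` PROPAGATOR, ALL DISTINCT PAIRS** (`d ≥ 1`): for odd `L ≥ 3`, `a > 0`,
`m₀² ≥ 0` there are `C, δ > 0` such that for EVERY `K ≥ 1`, cube `2L^e`, mass `0 < m² ≤ m₀²` and all `x ≠ y`:
`|∂^η_μG^η_K(x, y)| ≤ C·((L^K)∕r)^{d}·exp(−δ·|B(x) − B(y)|_M)` — the gradient power law of part R-c TIMES the block decay of part O-a′, uniformly in `K`,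
the volume and the mass, with no threshold (§1 + part R-b `levelSum_le_powerLaw` at `p = d`).  The (2.17)-summed SHAPE of the gradient clause of
Prop. 3.7 ∕ Theorem 3.3 for King's (2.13) at `A = 0`; nothing here is Bałaban's `∇G_k(U)`.
[cite: King1986, (2.13)–(2.17) p.653, Theorem 3.3 p.655, (3.7) p.656, Prop. 3.7 (3.63) p.663; Balaban1983RegularityDecay, Theorem (1.10) p.573] -/
theorem fullPropD_powerLaw_decay_unif (hd : 1 ≤ d) (hLodd : Odd L) (hL : 2 ≤ L) {a : ℝ} (ha : 0 < a) {m0sq : ℝ} (hm0 : 0 ≤ m0sq) :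
    ∃ C δ : ℝ, 0 < C ∧ 0 < δ ∧ ∀ (K : ℕ), 1 ≤ K → ∀ (N : ℕ) [NeZero N], N = L ^ K →
      ∀ (e : ℕ) (M : Fin (d + 1) → ℕ) [∀ μ, NeZero (M μ)], (∀ μ, M μ = 2 * L ^ e) →
      ∀ (msq : ℝ), 0 < msq → msq ≤ m0sq → ∀ (μ : Fin (d + 1)) (x y : Tor (fine N M)), x ≠ y →
        |(N : ℝ) * (constrainedProp N M (aK a L K) (((N : ℕ) : ℝ) ^ 2) msq (x + unitVec (fine N M) μ) y
            - constrainedProp N M (aK a L K) (((N : ℕ) : ℝ) ^ 2) msq x y)|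
          ≤ C * (((L : ℝ) ^ K) / tdistT (fine N M) x y) ^ d
            * Real.exp (-(δ * tdistT M (blockOf N M x) (blockOf N M y))) := by
  have hLr : (2 : ℝ) ≤ L := by exact_mod_cast hL
  have hL0 : (0 : ℝ) < L := by linarith
  obtain ⟨C₀, δ, hC₀, hδ, H⟩ := fullPropD_profile_decay_unif (d := d) L hLodd hL ha hm0
  have hp : 1 ≤ d := hd
  set Kp : ℝ := (2 * (d + 1).factorial / (δ / L) ^ (d + 1) + 2) / (L : ℝ) ^ d with hKp
  have hKp0 : 0 < Kp := by positivity
  refine ⟨C₀ * Kp, δ, mul_pos hC₀ hKp0, hδ, ?_⟩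
  intro K hK N _ hN e M _ hM msq hmsq hcap μ x y hxy
  have h := H K hK N hN e M hM msq hmsq hcap μ x y
  set r : ℝ := tdistT (fine N M) x y with hrdef
  set D : ℝ := tdistT M (blockOf N M x) (blockOf N M y) with hDdef
  have hr : 1 ≤ r := one_le_tdistT_of_ne (fine N M) hxy
  have hNc : (N : ℝ) = (L : ℝ) ^ K := by rw [hN]; push_cast; ring
  have hs : ∑ i ∈ Finset.range K, ((L : ℝ) ^ (d + 1) / (L : ℝ) ^ 2 * L) ^ i * Real.exp (-(δ * (r * (L : ℝ) ^ i / (N : ℝ))))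
      = ∑ i ∈ Finset.range K, ((L : ℝ) ^ d) ^ i * Real.exp (-(δ * (r * (L : ℝ) ^ i / (L : ℝ) ^ K))) :=
    Finset.sum_congr rfl fun i _ => by rw [LamL_eq_pow L hL, hNc]
  rw [hs] at h
  have hsum := levelSum_le_powerLaw hLr hδ hp K hr
  have hE : 0 ≤ Real.exp (-(δ * D)) := (Real.exp_pos _).le
  calc |(N : ℝ) * (constrainedProp N M (aK a L K) (((N : ℕ) : ℝ) ^ 2) msq (x + unitVec (fine N M) μ) y
            - constrainedProp N M (aK a L K) (((N : ℕ) : ℝ) ^ 2) msq x y)|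
      ≤ C₀ * (∑ i ∈ Finset.range K, ((L : ℝ) ^ d) ^ i * Real.exp (-(δ * (r * (L : ℝ) ^ i / (L : ℝ) ^ K))))
          * Real.exp (-(δ * D)) := h
    _ ≤ C₀ * (Kp * (((L : ℝ) ^ K) / r) ^ d) * Real.exp (-(δ * D)) :=
        mul_le_mul_of_nonneg_right (mul_le_mul_of_nonneg_left hsum hC₀.le) hE
    _ = C₀ * Kp * (((L : ℝ) ^ K) / r) ^ d * Real.exp (-(δ * D)) := by ring

/-- **THE DIAGONAL ORDER OF THE GRADIENT WITH THE BLOCK DECAY, ALL PAIRS** (`d ≥ 1`): `|∂^η_μG^η_K(x, y)| ≤ C·(L^K)^{d}·exp(−δ·|B(x) − B(y)|_M)` for all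
`x, y` (§1 + part R-b `levelSum_le_geom`). [cite: King1986, Prop. 3.7 (3.63) p.663, (2.20) p.654] -/
theorem fullPropD_diag_decay_le_unif (hd : 1 ≤ d) (hLodd : Odd L) (hL : 2 ≤ L) {a : ℝ} (ha : 0 < a) {m0sq : ℝ} (hm0 : 0 ≤ m0sq) :
    ∃ C δ : ℝ, 0 < C ∧ 0 < δ ∧ ∀ (K : ℕ), 1 ≤ K → ∀ (N : ℕ) [NeZero N], N = L ^ K →
      ∀ (e : ℕ) (M : Fin (d + 1) → ℕ) [∀ μ, NeZero (M μ)], (∀ μ, M μ = 2 * L ^ e) →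
      ∀ (msq : ℝ), 0 < msq → msq ≤ m0sq → ∀ (μ : Fin (d + 1)) (x y : Tor (fine N M)),
        |(N : ℝ) * (constrainedProp N M (aK a L K) (((N : ℕ) : ℝ) ^ 2) msq (x + unitVec (fine N M) μ) y
            - constrainedProp N M (aK a L K) (((N : ℕ) : ℝ) ^ 2) msq x y)|
          ≤ C * ((L : ℝ) ^ K) ^ d * Real.exp (-(δ * tdistT M (blockOf N M x) (blockOf N M y))) := by
  have hLr : (2 : ℝ) ≤ L := by exact_mod_cast hL
  have hL0 : (0 : ℝ) < L := by linarith
  obtain ⟨C₀, δ, hC₀, hδ, H⟩ := fullPropD_profile_decay_unif (d := d) L hLodd hL ha hm0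
  refine ⟨C₀, δ, hC₀, hδ, ?_⟩
  intro K hK N _ hN e M _ hM msq hmsq hcap μ x y
  have h := H K hK N hN e M hM msq hmsq hcap μ x y
  rw [LamL_eq_pow L hL] at h
  have hΛ2 : (2 : ℝ) ≤ (L : ℝ) ^ d := by
    calc (2 : ℝ) ≤ L := hLr
      _ = (L : ℝ) ^ 1 := (pow_one _).symm
      _ ≤ (L : ℝ) ^ d := pow_le_pow_right₀ (by linarith) hd
  have hgeom := levelSum_le_geom hΛ2 K (fun i => Real.exp (-(δ * (tdistT (fine N M) x y * (L : ℝ) ^ i / (N : ℝ)))))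
    (fun i => Real.exp_le_one_iff.mpr (by
      have := tdistT_nonneg (fine N M) x y
      have : 0 ≤ δ * (tdistT (fine N M) x y * (L : ℝ) ^ i / (N : ℝ)) := by positivity
      linarith))
  have hE : 0 ≤ Real.exp (-(δ * tdistT M (blockOf N M x) (blockOf N M y))) := (Real.exp_pos _).le
  calc |(N : ℝ) * (constrainedProp N M (aK a L K) (((N : ℕ) : ℝ) ^ 2) msq (x + unitVec (fine N M) μ) y
            - constrainedProp N M (aK a L K) (((N : ℕ) : ℝ) ^ 2) msq x y)|
      ≤ C₀ * (∑ i ∈ Finset.range K, ((L : ℝ) ^ d) ^ i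
          * Real.exp (-(δ * (tdistT (fine N M) x y * (L : ℝ) ^ i / (N : ℝ)))))
          * Real.exp (-(δ * tdistT M (blockOf N M x) (blockOf N M y))) := h
    _ ≤ C₀ * ((L : ℝ) ^ d) ^ K * Real.exp (-(δ * tdistT M (blockOf N M x) (blockOf N M y))) :=
        mul_le_mul_of_nonneg_right (mul_le_mul_of_nonneg_left hgeom hC₀.le) hE
    _ = C₀ * ((L : ℝ) ^ K) ^ d * Real.exp (-(δ * tdistT M (blockOf N M x) (blockOf N M y))) := by
        rw [← pow_mul, ← pow_mul, Nat.mul_comm]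

/-! ## §3 Part O-a′'s off-diagonal gradient decay with the threshold `2` -/

/-- **UNIFORM OFF-DIAGONAL GRADIENT DECAY WITH THRESHOLD `2`** (`d ≥ 1`): `∃ C, δ > 0 ∀ K ≥ 1 … ∀ μ x y, 2 ≤ |B(x) − B(y)|_M → |∂^η_μG^η_K(x, y)| ≤
C·e^{−δ|B(x) − B(y)|_M}` — part O-a′'s `fullPropD_decay_unif` with its threshold `D₀ = 1 + 2ΛL∕(δ(L−1))` replaced by `2` (unit blocks `≥ 2` apart
force `r ≥ L^K + 1`, so the power-law factor of §2 is `≤ 1`).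
[cite: King1986, (2.13)–(2.17) p.653, Theorem 3.3 p.655, (3.7) p.656, Prop. 3.7 (3.64) p.663; Balaban1983RegularityDecay, Theorem (1.10) p.573] -/
theorem fullPropD_decay_two_blocks_unif (hd : 1 ≤ d) (hLodd : Odd L) (hL : 2 ≤ L) {a : ℝ} (ha : 0 < a) {m0sq : ℝ} (hm0 : 0 ≤ m0sq) :
    ∃ C δ : ℝ, 0 < C ∧ 0 < δ ∧ ∀ (K : ℕ), 1 ≤ K → ∀ (N : ℕ) [NeZero N], N = L ^ K →
      ∀ (e : ℕ) (M : Fin (d + 1) → ℕ) [∀ μ, NeZero (M μ)], (∀ μ, M μ = 2 * L ^ e) →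
      ∀ (msq : ℝ), 0 < msq → msq ≤ m0sq →
      ∀ (μ : Fin (d + 1)) (x y : Tor (fine N M)), 2 ≤ tdistT M (blockOf N M x) (blockOf N M y) →
        |(N : ℝ) * (constrainedProp N M (aK a L K) (((N : ℕ) : ℝ) ^ 2) msq (x + unitVec (fine N M) μ) y
            - constrainedProp N M (aK a L K) (((N : ℕ) : ℝ) ^ 2) msq x y)|
          ≤ C * Real.exp (-(δ * tdistT M (blockOf N M x) (blockOf N M y))) := by
  obtain ⟨C, δ, hC, hδ, H⟩ := fullPropD_powerLaw_decay_unif (d := d) L hd hLodd hL ha hm0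
  refine ⟨C, δ, hC, hδ, ?_⟩
  intro K hK N _ hN e M _ hM msq hmsq hcap μ x y hD
  set r : ℝ := tdistT (fine N M) x y with hrdef
  set D : ℝ := tdistT M (blockOf N M x) (blockOf N M y) with hDdef
  have hN1 : (1 : ℝ) ≤ (N : ℝ) := by
    rw [hN]
    exact_mod_cast Nat.one_le_pow K L (by omega)
  have hND : (N : ℝ) * D ≤ r + ((N : ℝ) - 1) := mul_tdistT_blockOf_le N M x y
  -- `r ≥ N·D − (N − 1) ≥ 2N − N + 1 = N + 1`
  have hrN : (N : ℝ) + 1 ≤ r := by nlinarith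
  have hNc : (N : ℝ) = (L : ℝ) ^ K := by rw [hN]; push_cast; ring
  have hr0 : 0 < r := by linarith
  have hxy : x ≠ y := by
    intro hxy
    rw [hrdef, hxy, Literature.MathematicalPhysics.QuantumFieldTheory.King1986.Torus.tdistT_self] at hrN
    linarith
  have h := H K hK N hN e M hM msq hmsq hcap μ x y hxy
  have hratio : ((L : ℝ) ^ K) / r ≤ 1 := by
    rw [div_le_one hr0, ← hNc]
    linarith
  have hpow : (((L : ℝ) ^ K) / r) ^ d ≤ 1 := pow_le_one₀ (by positivity) hratio
  have hE : 0 ≤ Real.exp (-(δ * D)) := (Real.exp_pos _).le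
  calc |(N : ℝ) * (constrainedProp N M (aK a L K) (((N : ℕ) : ℝ) ^ 2) msq (x + unitVec (fine N M) μ) y
            - constrainedProp N M (aK a L K) (((N : ℕ) : ℝ) ^ 2) msq x y)|
      ≤ C * (((L : ℝ) ^ K) / r) ^ d * Real.exp (-(δ * D)) := h
    _ ≤ C * 1 * Real.exp (-(δ * D)) :=
        mul_le_mul_of_nonneg_right (mul_le_mul_of_nonneg_left hpow hC.le) hE
    _ = C * Real.exp (-(δ * D)) := by rw [mul_one]

end Summit.QuantumFields.YangMills.BalabanUVNodes.N15KingModelRung.Curved
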